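import Summits.ABC.ABC.Theorems.PlacewiseSzpiroSingleTowerSzpiroMersenneRadical
import Summits.ABC.Harvest.OpenQuestions
import Summits.ABC.Analytic.PolySzpiro
import HarnessLib

/-!
# Route PlacewiseSzpiro, line `birth`: the line's rungs against the radical of Mersenne numbers

Summits-side helper (theorems only; no definition, no named fact, no `Theses` import), sequel of
`…MersenneRadical.lean` (a slope-`K` `2`-adic single-tower bound ⟹ `rad(2ⁿ − 1) ≥ c · 2^{2n/K}`). The same Mersenne
Frey curves `W_n : y² = x(x+1)(x+2ⁿ)` (`N = 2 rad(2ⁿ−1)`, `Δ_min = 2^{2n−8}(2ⁿ−1)²`, `n ≥ 5`) calibrate the two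
WHOLE-DISCRIMINANT rungs between which the line is booked:

* `radical_mersenne_ge_of_polySzpiroRatEff` — **A-PS** with constants `(K, C)`
  (`Summit.ABC.PolySzpiroRatEff K C`: `log|Δ_min| ≤ K log N + C`, «NOT abc — POLY-SZPIRO(K)») gives
  **`rad(2ⁿ − 1) ≥ c · 2^{2n/K}`** (exponential in `n`); `radical_mersenne_ge_of_polySzpiroRat` packages `∃ K`.
* `radical_mersenne_ge_pow_of_subexponentialSzpiro` — the line's booked target rung **A1′**
  (`Summit.ABC.Harvest.SubexponentialSzpiro`: `log|Δ_min| ≤ C(ε) N^ε`) gives **`rad(2ⁿ − 1) ≥ c(A) · n^A` for EVERY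
  `A > 0`** (super-polynomial in `n`).

STATUS OF THE CONCLUSIONS (presearch 2026-08-27, corpus fts+vec and galaxy; census in
`Cruxes/SingleTowerSzpiro/Lines/birth.md` rev 5): unconditionally the tree's record is Stewart–Yu
(`Literature.Barriers.ABC.BakerMethodBounds`: `n log 2 ≤ κ R^{1/3}(log R)³`, i.e. `rad(2ⁿ−1) ≫ n³/(log n)⁹`) and, for the
largest prime factor, Stewart 2013 (`P(2ⁿ−1) > n exp(log n/(104 log log n))`, tree `StewartPadicOrder`); lifting the
exponent gives only `Σ_{q ∣ 2ⁿ−1} q ≥ n − O(ω log n)`. Neither an exponential bound (A-PS / S1 scale) nor a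
super-polynomial one (A1′ scale) for `rad(2ⁿ − 1)` is in print unconditionally; under abc, `rad(2ⁿ−1) ≫_ε 2^{(1−ε)n}`
(Silverman 1988, Murty–Wong 2002). So already on this one family the rungs A-PS ⊋ A1′ ask for new theorems about
Mersenne numbers of exactly the strength their names suggest.

HONESTY: implications between typed statements only; A-PS and A1′ are NOT abc; nothing is proved about them here;
typed ≠ proved.
-/

noncomputable section

-- `Summit.<Summit>.<Problem>` is the mandated summit-side namespace (CONVENTIONS §2); for the
-- single-conjunct summit `ABC` the two coincide, so the duplicate `ABC.ABC` is deliberate.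
set_option linter.dupNamespace false

namespace Summit.ABC.ABC.Theorems.SingleTowerSzpiroLine

open IsDedekindDomain UniqueFactorizationMonoid
open Literature.NumberTheory.EllipticCurves

/-- **`log|Δ_min(W_n)| ≥ (2n − 8) log 2`** for the Mersenne Frey curve (`Δ_min = 2^{2n−8}(2ⁿ−1)²`, `2ⁿ − 1 ≥ 1`).
[folklore] -/
theorem log_minimalDiscriminantNorm_freyCurve_mersenne_ge {n : ℕ} (hn : 5 ≤ n) :
    (2 * (n : ℝ) - 8) * Real.log 2 ≤
      Real.log (((freyCurve (-1) (2 ^ n)).minimalDiscriminantNorm ℤ : ℕ) : ℝ) := by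
  rw [minimalDiscriminantNorm_freyCurve_mersenne hn]
  have hm : 1 ≤ mersenne n := Nat.one_le_iff_ne_zero.mpr (by
    intro h; have := succ_mersenne n; rw [h] at this
    have : 2 ^ n ≥ 2 ^ 5 := Nat.pow_le_pow_right two_pos hn
    omega)
  have h1 : (2 : ℕ) ^ (2 * n - 8) ≤ 2 ^ (2 * n - 8) * mersenne n ^ 2 :=
    Nat.le_mul_of_pos_right _ (by positivity)
  have h2 : ((2 : ℝ)) ^ (2 * n - 8) ≤ ((2 ^ (2 * n - 8) * mersenne n ^ 2 : ℕ) : ℝ) := by exact_mod_cast h1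
  have hcast : ((2 * n - 8 : ℕ) : ℝ) = 2 * (n : ℝ) - 8 := by
    rw [Nat.cast_sub (by omega)]; push_cast; ring
  calc (2 * (n : ℝ) - 8) * Real.log 2 = Real.log ((2 : ℝ) ^ (2 * n - 8)) := by
        rw [Real.log_pow, hcast]
    _ ≤ _ := Real.log_le_log (by positivity) h2

/-- **A-PS with constants `(K, C)` ⟹ `rad(2ⁿ − 1) ≥ c · 2^{2n/K}`** (`K > 0`; `c = exp(−(8 log 2 + C)/K − log 2)`):
`(2n−8) log 2 ≤ log|Δ_min(W_n)| ≤ K log(2 rad(2ⁿ−1)) + C`. «NOT abc — POLY-SZPIRO(K)»; the conclusion is open for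
every exponent `> 0`. [folklore] -/
theorem radical_mersenne_ge_of_polySzpiroRatEff {K C : ℝ} (hK : 0 < K) (h : Summit.ABC.PolySzpiroRatEff K C) :
    ∃ c : ℝ, 0 < c ∧ ∀ n : ℕ, 5 ≤ n →
      c * (2 : ℝ) ^ ((2 / K) * n) ≤ ((radical (mersenne n) : ℕ) : ℝ) := by
  -- the whole-discriminant bound implies the `2`-adic tower bound with the same `(K, C)` on `W_n`; but it is
  -- quicker to run the Mersenne computation directly
  refine ⟨Real.exp (-(8 * Real.log 2 + C) / K - Real.log 2), Real.exp_pos _, fun n hn => ?_⟩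
  haveI := isElliptic_freyCurve_mersenne (n := n) (by omega)
  have h1 := h (freyCurve (-1) (2 ^ n))
  rw [conductorNorm_freyCurve_mersenne_eq hn] at h1
  have h0 := log_minimalDiscriminantNorm_freyCurve_mersenne_ge hn
  have hrad : (0 : ℝ) < ((radical (mersenne n) : ℕ) : ℝ) := by exact_mod_cast Nat.radical_pos _
  push_cast at h1
  rw [Real.log_mul two_ne_zero hrad.ne'] at h1
  -- `(2n−8) log 2 ≤ K (log 2 + log rad) + C`
  have h2 : ((2 * (n : ℝ) - 8) * Real.log 2 - C) / K - Real.log 2 ≤ Real.log ((radical (mersenne n) : ℕ) : ℝ) := by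
    rw [div_sub' (ne_of_gt hK), div_le_iff₀ hK]
    nlinarith
  have h3 : Real.exp (((2 * (n : ℝ) - 8) * Real.log 2 - C) / K - Real.log 2) ≤ ((radical (mersenne n) : ℕ) : ℝ) := by
    rw [← Real.exp_log hrad]; exact Real.exp_le_exp.mpr h2
  have hsplit : ((2 * (n : ℝ) - 8) * Real.log 2 - C) / K - Real.log 2 =
      (-(8 * Real.log 2 + C) / K - Real.log 2) + Real.log 2 * (2 / K * n) := by
    field_simp; ring
  have e2 : Real.exp (Real.log 2 * (2 / K * (n : ℝ))) = (2 : ℝ) ^ (2 / K * (n : ℝ)) := by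
    rw [Real.rpow_def_of_pos two_pos]
  rw [hsplit, Real.exp_add, e2] at h3
  exact h3

/-- **A-PS ⟹ an exponential lower bound for `rad(2ⁿ − 1)`**: `∃ θ > 0, ∃ c > 0, rad(2ⁿ−1) ≥ c · 2^{θn}` (`n ≥ 5`).
(`Summit.ABC.PolySzpiroRat = ∃ K C, PolySzpiroRatEff K C`; if `K ≤ 0` use `K = 1`, monotonicity in `K`.)
«NOT abc — POLY-SZPIRO(E)». [folklore] -/
theorem radical_mersenne_ge_of_polySzpiroRat (h : Summit.ABC.PolySzpiroRat) :
    ∃ θ : ℝ, 0 < θ ∧ ∃ c : ℝ, 0 < c ∧ ∀ n : ℕ, 5 ≤ n →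
      c * (2 : ℝ) ^ (θ * n) ≤ ((radical (mersenne n) : ℕ) : ℝ) := by
  obtain ⟨K, C, hKC⟩ := h
  -- replace `K` by `max K 1 > 0`
  have h' : Summit.ABC.PolySzpiroRatEff (max K 1) C := by
    intro W _
    have hN : (1 : ℝ) ≤ (W.conductorNorm ℤ : ℝ) := by exact_mod_cast WeierstrassCurve.conductorNorm_pos_holds W
    have hlog : 0 ≤ Real.log (W.conductorNorm ℤ : ℝ) := Real.log_nonneg hN
    exact (hKC W).trans (by nlinarith [le_max_left K 1])
  have hK : (0 : ℝ) < max K 1 := lt_of_lt_of_le one_pos (le_max_right K 1)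
  obtain ⟨c, hc0, hc⟩ := radical_mersenne_ge_of_polySzpiroRatEff hK h'
  exact ⟨2 / max K 1, by positivity, c, hc0, hc⟩

/-- **A1′ (`SubexponentialSzpiro`) ⟹ `rad(2ⁿ − 1) ≥ c(A) · n^A` for every `A > 0`** (`n ≥ 5`): at `ε = 1/A`,
`(2n−8) log 2 ≤ log|Δ_min(W_n)| ≤ C (2 rad)^{1/A}`, and `2n − 8 ≥ 2n/5` for `n ≥ 5`, so
`rad ≥ ((2 log 2/(5 C')) n)^A / 2` with `C' = max C 1`. The line's booked target rung, read on one family: a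
super-polynomial radical bound for Mersenne numbers, not in print unconditionally. «A1′ — NOT abc». [folklore] -/
theorem radical_mersenne_ge_pow_of_subexponentialSzpiro (h : Summit.ABC.Harvest.SubexponentialSzpiro)
    {A : ℝ} (hA : 0 < A) :
    ∃ c : ℝ, 0 < c ∧ ∀ n : ℕ, 5 ≤ n → c * (n : ℝ) ^ A ≤ ((radical (mersenne n) : ℕ) : ℝ) := by
  obtain ⟨C, hC⟩ := h (1 / A) (by positivity)
  set C' : ℝ := max C 1 with hC'
  have hC'1 : 1 ≤ C' := le_max_right _ _
  have hC'0 : 0 < C' := by linarith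
  refine ⟨(2 * Real.log 2 / (5 * C')) ^ A / 2, by
    have : 0 < 2 * Real.log 2 / (5 * C') := by have := Real.log_pos one_lt_two; positivity
    positivity, fun n hn => ?_⟩
  haveI := isElliptic_freyCurve_mersenne (n := n) (by omega)
  have h1 := hC (freyCurve (-1) (2 ^ n))
  rw [conductorNorm_freyCurve_mersenne_eq hn] at h1
  have h0 := log_minimalDiscriminantNorm_freyCurve_mersenne_ge hn
  have hrad : (0 : ℝ) < ((radical (mersenne n) : ℕ) : ℝ) := by exact_mod_cast Nat.radical_pos _
  push_cast at h1
  set R : ℝ := ((radical (mersenne n) : ℕ) : ℝ) with hRdef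
  have hl2 : 0 < Real.log 2 := Real.log_pos one_lt_two
  have hn5 : (5 : ℝ) ≤ n := by exact_mod_cast hn
  -- `(2n/5) log 2 ≤ (2n − 8) log 2 ≤ C (2R)^{1/A} ≤ C' (2R)^{1/A}`
  have hpow0 : 0 ≤ (2 * R) ^ (1 / A) := Real.rpow_nonneg (by linarith) _
  have hkey : (2 * (n : ℝ) / 5) * Real.log 2 ≤ C' * (2 * R) ^ (1 / A) := by
    have h2 : (2 * (n : ℝ) - 8) * Real.log 2 ≤ C * (2 * R) ^ (1 / A) := h0.trans h1
    have h3 : C * (2 * R) ^ (1 / A) ≤ C' * (2 * R) ^ (1 / A) :=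
      mul_le_mul_of_nonneg_right (le_max_left C 1) hpow0
    nlinarith
  -- divide by `C'` and raise to the power `A`
  have hx : (2 * Real.log 2 / (5 * C')) * n ≤ (2 * R) ^ (1 / A) := by
    rw [show (2 * Real.log 2 / (5 * C')) * n = ((2 * (n : ℝ) / 5) * Real.log 2) / C' by field_simp]
    rw [div_le_iff₀ hC'0]; linarith
  have hx0 : 0 ≤ (2 * Real.log 2 / (5 * C')) * n := by positivity
  have hA' : (2 * Real.log 2 / (5 * C') * n) ^ A ≤ ((2 * R) ^ (1 / A)) ^ A := Real.rpow_le_rpow hx0 hx hA.le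
  rw [← Real.rpow_mul (by linarith), one_div_mul_cancel hA.ne', Real.rpow_one,
    Real.mul_rpow (by positivity) (by positivity)] at hA'
  -- `(k n)^A = k^A n^A ≤ 2R`
  linarith

end Summit.ABC.ABC.Theorems.SingleTowerSzpiroLine

end
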